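import Summits.CriticalPhenomena.PercolationContinuityZ3.Theorems.PercNearOneGluingNoHeavyLowerTailSahiCoSunflowerAtomCovering
import Summits.CriticalPhenomena.PercolationContinuityZ3.Theorems.PercNearOneGluingNoHeavyLowerTailSahiStrongCubicMax
import Mathlib.Tactic.Linarith
import Mathlib.Tactic.Ring
import HarnessLib

/-!
# `NoHeavyLowerTail` (crux stmt-CriticalPhenomena-4575), master-family line P1 (gen 16):
# SHARPNESS of the one-payer inequality — on the OR-block standard system the outside pays EXACTLY (`e₃ = o·G`), so
# `strongCubicMax = (max(κ,o) − o)·G` vanishes whenever `κ ≤ o`: the factor `max(κ,o)` in `StrongCubicMaxNonneg` cannot be lowered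

Support file (seat `prim-masterthm-p1`, gen 16; `--supports stmt-CriticalPhenomena-4575`).  Pure proof file, no `sorry`, standard
axioms.  Memo `run/shared/lean/prim/prim-masterthm/FROM-prim-masterthm-p1-g16-ONE-PAYER.md` §0(ii), §3.

THE OR-BLOCK STANDARD SYSTEM.  Partition the coordinates into three blocks `P₀ ⊔ P₁ ⊔ P₂ = univ` and let `G_i = "some coordinate of
P_i is present"` (the composite std3 ∘ (OR_{P₀}, OR_{P₁}, OR_{P₂}); for singletons `P_i = {i}` this is the standard 3-coordinate system).
With `Q_i = ∏_{u ∈ P_i}(1 − p_u)` and `Q = Q₀Q₁Q₂`, the cells of the co-sunflower `(G₂∪G₃, G₁∪G₃, G₁∪G₂)` are EXACTLY the envelope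
values of the atom-covering transfer argument: outside `o = Q` (`= avoid univ`), petal `i = Q_jQ_k − Q` (`= avoid(P_j ∪ P_k) ∖ avoid univ`),
and Gladkov's defect is `G = κo − e₂ = Q(1−Q₀)(1−Q₁)(1−Q₂)` while `e₃ = Q·G`:
* `orBlock_cells` — the three petal masses and the outside mass in closed form;
* `strongCubicMax_orBlock` — **`strongCubicMax = (max(κ,o) − o) · Q(1−Q₀)(1−Q₁)(1−Q₂)`**;
* `strongCubicMax_orBlock_eq_zero` — **`= 0` whenever `κ ≤ o`** (equality case of S₃^max on a full-dimensional bias region), and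
  `gladkovDefect_orBlock` (`G = Q(1−Q₀)(1−Q₁)(1−Q₂)`), `outsidePays_orBlock` (`e₃ = o·G`: the outside pays exactly).
Consequently no inequality `e₃ ≤ f(κ,o)·G` with `f(κ,o) < o` somewhere on `{κ ≤ o}` can hold for all systems (and dually with
`f < κ` on `{o ≤ κ}`), i.e. `max(κ,o)` is the least admissible factor — the content of "S₃^max is sharp" in the memo. [this work]
-/

noncomputable section

open scoped Classical

namespace Summit.CriticalPhenomena.PercolationContinuityZ3.Theorems

namespace SahiDeepCore

open Finset
open Literature.Combinatorics.Sahi2008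
open Literature.Probability.Percolation.DecisionTree (ind ind_of_mem ind_of_not_mem ind_nonneg)

variable {ι : Type} [Fintype ι]

local notation3 (prettyPrint := false) "m⟦" p ", " X "⟧" => ex (bernoulliWeight p) (ind X)

omit [Fintype ι] in
/-- The OR-event of a block: "some coordinate of `P` is present". [this work] -/
private theorem isUpperSet_hits (P : Finset ι) : IsUpperSet ((avoid P)ᶜ : Set (Set ι)) := by
  intro S T hST hS hT
  exact hS fun u hu huS => hT u hu (hST huS)

/-- `μ_p(Y ∖ X) = μ_p(Y) − μ_p(X)` for `X ⊆ Y`. [folklore] -/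
private theorem massSh_sdiff (p : ι → unitInterval) {X Y : Set (Set ι)} (h : X ⊆ Y) :
    m⟦p, Y \ X⟧ = m⟦p, Y⟧ - m⟦p, X⟧ := by
  have e : ind Y = ind X + ind (Y \ X) := by
    funext ω
    simp only [Pi.add_apply]
    by_cases hx : ω ∈ X
    · rw [ind_of_mem (h hx), ind_of_mem hx, ind_of_not_mem (fun hh : ω ∈ Y \ X => hh.2 hx), add_zero]
    · by_cases hy : ω ∈ Y
      · rw [ind_of_mem hy, ind_of_not_mem hx, ind_of_mem (show ω ∈ Y \ X from ⟨hy, hx⟩), zero_add]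
      · rw [ind_of_not_mem hy, ind_of_not_mem hx, ind_of_not_mem (fun hh : ω ∈ Y \ X => hy hh.1), add_zero]
  have := congrArg (ex (bernoulliWeight p)) e
  rw [ex_add] at this
  linarith

/-- In the OR-block system with `P₀ ⊔ P₁ ⊔ P₂ = univ`, the private part "only `G₀`" (hits `P₀`, avoids `P₁ ∪ P₂`) is
`avoid(P₁ ∪ P₂) ∖ avoid univ`. [this work] -/
private theorem only_eq (P₀ P₁ P₂ : Finset ι) (hcov : P₀ ∪ P₁ ∪ P₂ = Finset.univ) :
    ((avoid P₀)ᶜ : Set (Set ι)) \ ((avoid P₁)ᶜ ∪ (avoid P₂)ᶜ) = avoid (P₁ ∪ P₂) \ avoid Finset.univ := by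
  ext S
  simp only [Set.mem_sdiff, Set.mem_compl_iff, Set.mem_union, not_or, not_not, mem_avoid, Finset.mem_union, Finset.mem_univ,
    forall_const]
  constructor
  · rintro ⟨h0, h1, h2⟩
    refine ⟨fun u hu => hu.elim (h1 u) (h2 u), fun hall => h0 fun u _ => hall u⟩
  · rintro ⟨h12, hall⟩
    refine ⟨fun h0 => hall fun u => ?_, fun u hu => h12 u (Or.inl hu), fun u hu => h12 u (Or.inr hu)⟩
    have hu : u ∈ P₀ ∪ P₁ ∪ P₂ := hcov ▸ Finset.mem_univ u
    rcases Finset.mem_union.1 hu with hu | hu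
    · rcases Finset.mem_union.1 hu with hu | hu
      · exact h0 u hu
      · exact h12 u (Or.inl hu)
    · exact h12 u (Or.inr hu)

/-- **Cells of the OR-block standard system in closed form.**  For a block partition `P₀ ⊔ P₁ ⊔ P₂ = univ` and
`G_i = (avoid P_i)ᶜ`: outside mass `Q₀Q₁Q₂`, petal masses `Q₀Q₂ − Q₀Q₁Q₂` (`A∖B` = only `G₁`), `Q₁Q₂ − Q₀Q₁Q₂` (only `G₀`),
`Q₀Q₁ − Q₀Q₁Q₂` (only `G₂`), with `Q_i = ∏_{u∈P_i}(1−p_u)`. [this work] -/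
theorem orBlock_cells (p : ι → unitInterval) (P₀ P₁ P₂ : Finset ι) (h01 : Disjoint P₀ P₁) (h02 : Disjoint P₀ P₂)
    (h12 : Disjoint P₁ P₂) (hcov : P₀ ∪ P₁ ∪ P₂ = Finset.univ) :
    m⟦p, (((avoid P₁)ᶜ ∪ (avoid P₂)ᶜ) ∪ ((avoid P₀)ᶜ ∪ (avoid P₂)ᶜ))ᶜ⟧ =
        (∏ u ∈ P₀, (1 - (p u : ℝ))) * (∏ u ∈ P₁, (1 - (p u : ℝ))) * (∏ u ∈ P₂, (1 - (p u : ℝ))) ∧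
      m⟦p, ((avoid P₁)ᶜ ∪ (avoid P₂)ᶜ) \ ((avoid P₀)ᶜ ∪ (avoid P₂)ᶜ)⟧ =
        (∏ u ∈ P₀, (1 - (p u : ℝ))) * (∏ u ∈ P₂, (1 - (p u : ℝ)))
          - (∏ u ∈ P₀, (1 - (p u : ℝ))) * (∏ u ∈ P₁, (1 - (p u : ℝ))) * (∏ u ∈ P₂, (1 - (p u : ℝ))) ∧
      m⟦p, ((avoid P₀)ᶜ ∪ (avoid P₂)ᶜ) \ ((avoid P₁)ᶜ ∪ (avoid P₂)ᶜ)⟧ =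
        (∏ u ∈ P₁, (1 - (p u : ℝ))) * (∏ u ∈ P₂, (1 - (p u : ℝ)))
          - (∏ u ∈ P₀, (1 - (p u : ℝ))) * (∏ u ∈ P₁, (1 - (p u : ℝ))) * (∏ u ∈ P₂, (1 - (p u : ℝ))) ∧
      m⟦p, (((avoid P₁)ᶜ ∪ (avoid P₂)ᶜ) ∩ ((avoid P₀)ᶜ ∪ (avoid P₂)ᶜ)) \ ((avoid P₀)ᶜ ∪ (avoid P₁)ᶜ)⟧ =
        (∏ u ∈ P₀, (1 - (p u : ℝ))) * (∏ u ∈ P₁, (1 - (p u : ℝ)))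
          - (∏ u ∈ P₀, (1 - (p u : ℝ))) * (∏ u ∈ P₁, (1 - (p u : ℝ))) * (∏ u ∈ P₂, (1 - (p u : ℝ))) := by
  obtain ⟨e3, e2, e1⟩ := coSunflower_privateParts ((avoid P₀)ᶜ : Set (Set ι)) (avoid P₁)ᶜ (avoid P₂)ᶜ
  have hprod : ∏ u ∈ (Finset.univ : Finset ι), (1 - (p u : ℝ)) =
      (∏ u ∈ P₀, (1 - (p u : ℝ))) * (∏ u ∈ P₁, (1 - (p u : ℝ))) * (∏ u ∈ P₂, (1 - (p u : ℝ))) := by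
    rw [← hcov, Finset.prod_union (Finset.disjoint_union_left.2 ⟨h02, h12⟩), Finset.prod_union h01]
  have hsubU : ∀ R : Finset ι, avoid Finset.univ ⊆ avoid R := fun R => avoid_mono (Finset.subset_univ R)
  have env : ∀ R : Finset ι, m⟦p, avoid R \ avoid Finset.univ⟧ = (∏ u ∈ R, (1 - (p u : ℝ)))
      - (∏ u ∈ P₀, (1 - (p u : ℝ))) * (∏ u ∈ P₁, (1 - (p u : ℝ))) * (∏ u ∈ P₂, (1 - (p u : ℝ))) := by
    intro R; rw [massSh_sdiff p (hsubU R), m_avoid, m_avoid, hprod]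
  -- outside
  have hout : (((avoid P₁)ᶜ ∪ (avoid P₂)ᶜ) ∪ ((avoid P₀)ᶜ ∪ (avoid P₂)ᶜ))ᶜ = (avoid (Finset.univ : Finset ι) : Set (Set ι)) := by
    ext S
    simp only [Set.mem_compl_iff, Set.mem_union, not_or, not_not, mem_avoid, Finset.mem_univ, forall_const]
    constructor
    · rintro ⟨⟨h1, h2⟩, h0, -⟩ u
      have hu : u ∈ P₀ ∪ P₁ ∪ P₂ := hcov ▸ Finset.mem_univ u
      rcases Finset.mem_union.1 hu with hu | hu
      · rcases Finset.mem_union.1 hu with hu | hu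
        · exact h0 u hu
        · exact h1 u hu
      · exact h2 u hu
    · intro h; exact ⟨⟨fun u _ => h u, fun u _ => h u⟩, fun u _ => h u, fun u _ => h u⟩
  -- covers with permuted blocks
  have hcov1 : P₁ ∪ P₀ ∪ P₂ = Finset.univ := by rw [← hcov]; ext u; simp only [Finset.mem_union]; tauto
  have hcov2 : P₂ ∪ P₀ ∪ P₁ = Finset.univ := by rw [← hcov]; ext u; simp only [Finset.mem_union]; tauto
  refine ⟨by rw [hout, m_avoid, hprod], ?_, ?_, ?_⟩
  · rw [e2, only_eq P₁ P₀ P₂ hcov1, env, Finset.prod_union h02]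
  · rw [e1, only_eq P₀ P₁ P₂ hcov, env, Finset.prod_union h12]
  · rw [e3, only_eq P₂ P₀ P₁ hcov2, env, Finset.prod_union h01]

/-- **THEOREM (one-payer value on the OR-block standard system).**  With `Q_i = ∏_{u∈P_i}(1−p_u)`, `Q = Q₀Q₁Q₂` and the core mass `κ`:
`strongCubicMax = (max(κ, Q) − Q) · (Q(1−Q₀)(1−Q₁)(1−Q₂))` — the outside pays exactly. [this work] -/
theorem strongCubicMax_orBlock (p : ι → unitInterval) (P₀ P₁ P₂ : Finset ι) (h01 : Disjoint P₀ P₁) (h02 : Disjoint P₀ P₂)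
    (h12 : Disjoint P₁ P₂) (hcov : P₀ ∪ P₁ ∪ P₂ = Finset.univ) :
    strongCubicMax p ((avoid P₁)ᶜ ∪ (avoid P₂)ᶜ) ((avoid P₀)ᶜ ∪ (avoid P₂)ᶜ) ((avoid P₀)ᶜ ∪ (avoid P₁)ᶜ) =
      (max (m⟦p, ((avoid P₁)ᶜ ∪ (avoid P₂)ᶜ) ∩ ((avoid P₀)ᶜ ∪ (avoid P₂)ᶜ) ∩ ((avoid P₀)ᶜ ∪ (avoid P₁)ᶜ)⟧)
            ((∏ u ∈ P₀, (1 - (p u : ℝ))) * (∏ u ∈ P₁, (1 - (p u : ℝ))) * (∏ u ∈ P₂, (1 - (p u : ℝ))))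
          - (∏ u ∈ P₀, (1 - (p u : ℝ))) * (∏ u ∈ P₁, (1 - (p u : ℝ))) * (∏ u ∈ P₂, (1 - (p u : ℝ)))) *
        ((∏ u ∈ P₀, (1 - (p u : ℝ))) * (∏ u ∈ P₁, (1 - (p u : ℝ))) * (∏ u ∈ P₂, (1 - (p u : ℝ))) *
          ((1 - ∏ u ∈ P₀, (1 - (p u : ℝ))) * (1 - ∏ u ∈ P₁, (1 - (p u : ℝ))) * (1 - ∏ u ∈ P₂, (1 - (p u : ℝ))))) := by
  obtain ⟨ho, hα, hβ, hd⟩ := orBlock_cells p P₀ P₁ P₂ h01 h02 h12 hcov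
  set A : Set (Set ι) := (avoid P₁)ᶜ ∪ (avoid P₂)ᶜ
  set B : Set (Set ι) := (avoid P₀)ᶜ ∪ (avoid P₂)ᶜ
  set N : Set (Set ι) := (avoid P₀)ᶜ ∪ (avoid P₁)ᶜ
  set Q0 := ∏ u ∈ P₀, (1 - (p u : ℝ))
  set Q1 := ∏ u ∈ P₁, (1 - (p u : ℝ))
  set Q2 := ∏ u ∈ P₂, (1 - (p u : ℝ))
  have hsum := cells_sum_eq_one p A B N
  have hk : m⟦p, A ∩ B ∩ N⟧ = 1 - m⟦p, (A ∪ B)ᶜ⟧ - m⟦p, A \ B⟧ - m⟦p, B \ A⟧ - m⟦p, (A ∩ B) \ N⟧ := by linarith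
  simp only [strongCubicMax, gladkovDefect]
  rw [ho, hα, hβ, hd]
  rw [ho, hα, hβ, hd] at hk
  rw [hk]
  ring

/-- **Gladkov's defect of the OR-block standard system**: `G = Q(1−Q₀)(1−Q₁)(1−Q₂)`. [this work] -/
theorem gladkovDefect_orBlock (p : ι → unitInterval) (P₀ P₁ P₂ : Finset ι) (h01 : Disjoint P₀ P₁) (h02 : Disjoint P₀ P₂)
    (h12 : Disjoint P₁ P₂) (hcov : P₀ ∪ P₁ ∪ P₂ = Finset.univ) :
    gladkovDefect p ((avoid P₁)ᶜ ∪ (avoid P₂)ᶜ) ((avoid P₀)ᶜ ∪ (avoid P₂)ᶜ) ((avoid P₀)ᶜ ∪ (avoid P₁)ᶜ) =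
      (∏ u ∈ P₀, (1 - (p u : ℝ))) * (∏ u ∈ P₁, (1 - (p u : ℝ))) * (∏ u ∈ P₂, (1 - (p u : ℝ))) *
        ((1 - ∏ u ∈ P₀, (1 - (p u : ℝ))) * (1 - ∏ u ∈ P₁, (1 - (p u : ℝ))) * (1 - ∏ u ∈ P₂, (1 - (p u : ℝ)))) := by
  obtain ⟨ho, hα, hβ, hd⟩ := orBlock_cells p P₀ P₁ P₂ h01 h02 h12 hcov
  set A : Set (Set ι) := (avoid P₁)ᶜ ∪ (avoid P₂)ᶜ
  set B : Set (Set ι) := (avoid P₀)ᶜ ∪ (avoid P₂)ᶜ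
  set N : Set (Set ι) := (avoid P₀)ᶜ ∪ (avoid P₁)ᶜ
  have hsum := cells_sum_eq_one p A B N
  have hk : m⟦p, A ∩ B ∩ N⟧ = 1 - m⟦p, (A ∪ B)ᶜ⟧ - m⟦p, A \ B⟧ - m⟦p, B \ A⟧ - m⟦p, (A ∩ B) \ N⟧ := by linarith
  simp only [gladkovDefect]
  rw [hk, ho, hα, hβ, hd]
  ring

/-- **The outside pays exactly on the OR-block standard system**: `e₃ = o · G`. [this work] -/
theorem outsidePays_orBlock (p : ι → unitInterval) (P₀ P₁ P₂ : Finset ι) (h01 : Disjoint P₀ P₁) (h02 : Disjoint P₀ P₂)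
    (h12 : Disjoint P₁ P₂) (hcov : P₀ ∪ P₁ ∪ P₂ = Finset.univ) :
    m⟦p, ((avoid P₁)ᶜ ∪ (avoid P₂)ᶜ) \ ((avoid P₀)ᶜ ∪ (avoid P₂)ᶜ)⟧ *
        m⟦p, ((avoid P₀)ᶜ ∪ (avoid P₂)ᶜ) \ ((avoid P₁)ᶜ ∪ (avoid P₂)ᶜ)⟧ *
        m⟦p, (((avoid P₁)ᶜ ∪ (avoid P₂)ᶜ) ∩ ((avoid P₀)ᶜ ∪ (avoid P₂)ᶜ)) \ ((avoid P₀)ᶜ ∪ (avoid P₁)ᶜ)⟧ =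
      m⟦p, (((avoid P₁)ᶜ ∪ (avoid P₂)ᶜ) ∪ ((avoid P₀)ᶜ ∪ (avoid P₂)ᶜ))ᶜ⟧ *
        gladkovDefect p ((avoid P₁)ᶜ ∪ (avoid P₂)ᶜ) ((avoid P₀)ᶜ ∪ (avoid P₂)ᶜ) ((avoid P₀)ᶜ ∪ (avoid P₁)ᶜ) := by
  rw [gladkovDefect_orBlock p P₀ P₁ P₂ h01 h02 h12 hcov]
  obtain ⟨ho, hα, hβ, hd⟩ := orBlock_cells p P₀ P₁ P₂ h01 h02 h12 hcov
  rw [ho, hα, hβ, hd]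
  ring

/-- **EQUALITY CASE of S₃^max**: on the OR-block standard system with `κ ≤ o` (core no heavier than the outside),
`strongCubicMax = 0` — so the factor `max(κ,o)` in `StrongCubicMaxNonneg` cannot be lowered on `{κ ≤ o}` (dually on `{o ≤ κ}`). [this work] -/
theorem strongCubicMax_orBlock_eq_zero (p : ι → unitInterval) (P₀ P₁ P₂ : Finset ι) (h01 : Disjoint P₀ P₁) (h02 : Disjoint P₀ P₂)
    (h12 : Disjoint P₁ P₂) (hcov : P₀ ∪ P₁ ∪ P₂ = Finset.univ)
    (hκo : m⟦p, ((avoid P₁)ᶜ ∪ (avoid P₂)ᶜ) ∩ ((avoid P₀)ᶜ ∪ (avoid P₂)ᶜ) ∩ ((avoid P₀)ᶜ ∪ (avoid P₁)ᶜ)⟧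
      ≤ m⟦p, (((avoid P₁)ᶜ ∪ (avoid P₂)ᶜ) ∪ ((avoid P₀)ᶜ ∪ (avoid P₂)ᶜ))ᶜ⟧) :
    strongCubicMax p ((avoid P₁)ᶜ ∪ (avoid P₂)ᶜ) ((avoid P₀)ᶜ ∪ (avoid P₂)ᶜ) ((avoid P₀)ᶜ ∪ (avoid P₁)ᶜ) = 0 := by
  rw [strongCubicMax_orBlock p P₀ P₁ P₂ h01 h02 h12 hcov]
  obtain ⟨ho, -, -, -⟩ := orBlock_cells p P₀ P₁ P₂ h01 h02 h12 hcov
  rw [ho] at hκo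
  rw [max_eq_right hκo, sub_self, zero_mul]

omit [Fintype ι] in
/-- The OR-block events are increasing, so the equality case lies inside the scope of `StrongCubicMaxNonneg`
(which quantifies over increasing sandwiched triples). [this work] -/
theorem isUpperSet_orBlock (P Q : Finset ι) : IsUpperSet (((avoid P)ᶜ ∪ (avoid Q)ᶜ : Set (Set ι))) :=
  (isUpperSet_hits P).union (isUpperSet_hits Q)

end SahiDeepCore

end Summit.CriticalPhenomena.PercolationContinuityZ3.Theorems
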